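import Summits.QuantumFields.YangMills.Theorems.BalabanUVNodesN06StepL2AtPinsPhysRParG

/-!
# BalabanUVNodes ∕ N06 ([B9], `Dag.B9_main`) — R1 J-TWIN (KD‴ LEGS): THE BLOCK-L² STEP OF THEOREM 3.12 (Π-block bound + the residual-form `StepL2`) AT THE REGULAR
# CARRIER, SITE-TRANSPORTER-PARAMETRIC, ALONG A SUB-FAMILY `f : J → MemberY …` — the J-twins of ✓`…N06StepL2AtPinsPhysRParG.blockBd_tpi_of_letter_schemasR_parG`
# (consumer «KD‴» l.302) and ✓`….stepL2_of_letter_schemas_residualR_parG` (consumer dag-n06-l's L2 `…Level13D2Rgdd13LayerAtPinsPUWParGQ` l.229)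

Track A of `YM-PLAN.md` (cell `pub-ymgap`, HUMAN RULING D-0062), node **N06** = [Balaban1985BackgroundPropagators]; IR-N06-SECTION-2 road **R1** («J-twin of the
producer cone», ★★★ director-ym №524 (3): authorised in principle, STAGED, sibling files only), `R1-JTWIN-SPEC.md` rule (R)′ (dag-n06-d, 2026-08-31): re-key EXACTLY
the section-tainted ∀-member rows along `f`, keep data ∕ pins ∕ laws ∕ section-free rows member-wide, tainted conclusions along `f` ((R).3′).
Seat `pub-ymgap-dag-n06-d` g30 — own-producer twins under «KD‴».  The parent's middle theorem `stepL2_of_letter_schemasR_parG` has no consumer in the cone and is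
NOT twinned (the residual form calls the Π-block bound directly).

WHAT.  `blockBd_tpi_of_letter_schemasR_parG_J` ∕ `stepL2_of_letter_schemas_residualR_parG_J` = the parent's theorems with `{J : Type} (f : J → MemberY d ℓ hd hL b₀ b₁ Mstar)`
added after the `H` binder and
* TAINTED ROWS: `h49` — print's (3.49) majorant for `P` (⟸ (3.48) rows 15∕16 via `…N06Proj349AtPinsPhysRCPar`) in both; `hD2L2` — the Δ⁽²⁾ block-L² letter (in L2
  the Sect.-D output `hD2sup` ⟸ row 17 through dag-n06-l's (8)–(10)) in the residual form; each re-keyed `∀ x : MemberY … ↦ ∀ j : J`, read at `f j`;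
* LEFT member-wide: the symmetry laws `hsymT hsymRT`, Theorem 3.1 `h31`, the (3.46) knit row `h46`, the current letters `hBJ`, the pins `hTpico12 hT2co12 …`, the
  letter families, all x-free numerics ∕ rates ∕ budgets (`θ₂ t2L …`);
* conclusions `∃ ML, ∀ j : J, …` along `f`; the residual form calls `blockBd_tpi_of_letter_schemasR_parG_J … H f R₁ R₂ …` (one token `f` inserted in the parent's
  positional call).
PROOF: the parent's text by generator (`mkJ.py` over the tree bytes): x-free ∃-thresholds; pointwise bodies `fun x ↦ fun j`, member reads `x ↦ f j`, `h49 x ↦ h49 j`,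
`hD2L2 x ↦ hD2L2 j`; the private helpers `kernel_dom` ∕ `isTransposePair_smul_smul` restated privately as in the parent; nothing re-derived.
HONEST FRAMING.  Bookkeeping over landed objects; every displayed row is a HYPOTHESIS; nothing of [B9] ∕ [4] asserted; COUNT-NEUTRAL (`--supports stmt-QuantumFields-27239
--as helper`); N06 NOT discharged; K1 NOT closed; under R1 the inner-corner question stays DISPLAYED at the K1 face ∕ NODE O join by (α5); nothing continuum ∕ OS ∕
mass gap ∕ Clay.  0 `def`, 0 `sorry`.  NEW file; the parent untouched.  The member-wide parent is the instance `J := MemberY …`, `f := id`; ORPHAN by design until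
its consumer twin lands (honest).
[cite: Balaban1985BackgroundPropagators, Thm 3.12 (3.137)–(3.138) p.423, (3.130)–(3.133) pp.421–422, Thm 3.1 p.394, (3.46) p.398, (3.49) p.398;
Balaban1984PropagatorsII, (2.51)–(2.56) pp.232–233, Lemma 2.1 (2.60)–(2.61) p.234]
-/

noncomputable section

namespace Summit.QuantumFields.YangMills.BalabanUVNodes.N06StepL2AtPinsPhysRParGJ
open Literature.MathematicalPhysics.QuantumFieldTheory.Balaban1983to89
open Literature.MathematicalPhysics.QuantumFieldTheory.Balaban1983to89.Node00 (CfgY GpY GpPhysY parSymY hessY_isSymmTr isAdjTr_comp isAdjTr_of_isSymmTr)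
open Literature.MathematicalPhysics.QuantumFieldTheory.Balaban1983to89.Node00.OpsYSectDCoords (DvcoKH DvscoKH RcoK TpicoK T2coK isTransposePair_DvcoKH_DvscoKH
  isTransposePair_RcoK isTransposePair_coordOpKH_trBasis)
open Literature.MathematicalPhysics.QuantumFieldTheory.Balaban1983to89.B9Thm34Ext (toB6)
open Literature.MathematicalPhysics.QuantumFieldTheory.Balaban1983to89.B11SectG (BlockNorm HasMaj RowSum)
open Literature.MathematicalPhysics.QuantumFieldTheory.Balaban1983to89.B9SectDL2Decay (BlockBd)
open Literature.MathematicalPhysics.QuantumFieldTheory.Balaban1983to89.B9Thm37Glue (IsTransposePair isTransposePair_one)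
open Literature.MathematicalPhysics.QuantumFieldTheory.Balaban1983to89.B9Thm312Whole (GeoOK)
open Literature.MathematicalPhysics.QuantumFieldTheory.Balaban1983to89.B9Thm312WholeL2 (StepL2)
open Literature.MathematicalPhysics.QuantumFieldTheory.Balaban1983to89.B9RWSums343to347Whole (Facts347)
open Literature.MathematicalPhysics.QuantumFieldTheory.Balaban1983to89.B9RWSumsDefinitePins (PinPrims)
open Literature.MathematicalPhysics.QuantumFieldTheory.Balaban1983to89.B9RWSums347DefiniteFaces (exp261 lemma21Pack_geo9Y)
open Literature.MathematicalPhysics.QuantumFieldTheory.Balaban1983to89.B9RowSum261DefiniteFaces (rowConst261 rowConst261_nonneg rowConst261_spec_of_rowSum261)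
open Literature.MathematicalPhysics.QuantumFieldTheory.Balaban1983to89.B9PinMembersKLevelV1 (MemberY geo9Y bg9Y)
open Literature.MathematicalPhysics.QuantumFieldTheory.Balaban1983to89.B9BackgroundsKLevelV1R (RegFamY bg9YR MemOfFam)
open Summit.QuantumFields.YangMills.BalabanUVNodes.N06StepL2AtPinsPhys (isTransposePair_BcoKH_BdcoKH)
open Literature.MathematicalPhysics.QuantumFieldTheory.Balaban1983to89.B9GeoLemma21KLevelV1 (geo9Y_len_pos geo9Y_dist_triangle geo9Y_dist_comm rowSum261_geo9Y)
open Literature.MathematicalPhysics.QuantumFieldTheory.Balaban1983to89.B9GeoNormsKLevelV1 (geo9K_dist_nonneg)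
open Literature.MathematicalPhysics.QuantumFieldTheory.Balaban1983to89.B7Prop2SpecialUnitary (specialUnitaryUnits specialUnitaryUnits_le_unitaryUnits)
open Literature.MathematicalPhysics.QuantumFieldTheory.Balaban1983to89.B9CoReadingCoords (XBK)
open Literature.MathematicalPhysics.QuantumFieldTheory.Balaban1983to89.B9CoReadingCoordsH (XHK)
open Literature.MathematicalPhysics.QuantumFieldTheory.Balaban1983to89.B9CoReadingCoordsS (XSK GcoS)
open Literature.MathematicalPhysics.QuantumFieldTheory.Balaban1983to89.B9CoReadingCoordsTranspose (TrIdx trBasis isTransposePair_GcoS_trBasis)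
open Literature.MathematicalPhysics.QuantumFieldTheory.Balaban1983to89.B9Thm39ReadingCoords (cR39)
open Literature.MathematicalPhysics.QuantumFieldTheory.Balaban1983to89.Node00.OpsYSectDCoords (cR39_trBasis_pos)
open Literature.MathematicalPhysics.QuantumFieldTheory.Balaban1983to89.B9PerturbationSplitAtLetters (TaLcoK TbLcoKH tpicoK_eq_splitL hessGradY divHessY)
open Literature.MathematicalPhysics.QuantumFieldTheory.Balaban1983to89.B9PerturbationMajorantAlgebra (Thm31GpMaj Proj349Maj CurrentMaj)
open Literature.MathematicalPhysics.QuantumFieldTheory.Balaban1983to89.B9PerturbationMajorantsAtLetters (BcoKH BdcoKH PcoK rcoK_eq)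
open Literature.MathematicalPhysics.QuantumFieldTheory.Balaban1983to89.B9PerturbationMajorantsAtLettersPhys (taLcoK_phys_eq_comp tbLcoKH_phys_eq_comp)
open Literature.MathematicalPhysics.QuantumFieldTheory.Balaban1983to89.B9PerturbationL2Algebra (Thm31GpL2Mixed)
open Literature.MathematicalPhysics.QuantumFieldTheory.Balaban1983to89.B9PerturbationL2Letters (constL2 constL2_nonneg blockBd_tpi_of_split stepL2_of_blockBd)
open Literature.MathematicalPhysics.QuantumFieldTheory.Balaban1983to89.B9PerturbationL2Delta2 (D2coK constL2Pi constL2Pi_nonneg blockBd_t2_of_residual t2coK_phys_eq_sandwich)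
open Literature.MathematicalPhysics.QuantumFieldTheory.Balaban1983to89.B9Thm311AdjointPairs (GpY_isSymmTr isAdjTr_gradY_divY)
open Literature.MathematicalPhysics.QuantumFieldTheory.Balaban1983to89.B9Thm311SymmAtRecordV4 (symm0_parSymY)
open scoped Matrix.Norms.L2Operator
variable {N : ℕ} [NeZero N]
variable {d ℓ : ℕ} {hd : 1 ≤ d + 1} {hL : Odd (ℓ + 1) ∧ 1 < ℓ + 1} {b₀ b₁ : ℝ} {Mstar : ℕ}
variable [∀ x : MemberY d ℓ hd hL b₀ b₁ Mstar, Fintype (geo9Y x).Site]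
/-- the kernel domination: `C·t_J·θ·w ≤ t·θ·w` for `C·t_J ≤ t`, `θ, w ≥ 0`. [cite: Balaban1985BackgroundPropagators, (3.131) p.422, bookkeeping] -/
private theorem kernel_dom {C tJ t θ u v e : ℝ} (hCt : C * tJ ≤ t) (hθ : 0 ≤ θ) (hu : 0 ≤ u) (hv : 0 ≤ v) (he : 0 ≤ e) :
    C * (tJ * θ) * u * v * e ≤ t * θ * u * v * e := by
  have h1 : C * (tJ * θ) ≤ t * θ := by rw [← mul_assoc]; exact mul_le_mul_of_nonneg_right hCt hθ
  exact mul_le_mul_of_nonneg_right (mul_le_mul_of_nonneg_right (mul_le_mul_of_nonneg_right h1 hu) hv) he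
/-- a transpose pair scaled on both sides by the same real is a transpose pair (def-Y's private lemma, re-proved). [folklore] -/
private theorem isTransposePair_smul_smul {X Y : Type} [Fintype X] [Fintype Y] {A : (X → ℝ) →ₗ[ℝ] (Y → ℝ)} {B : (Y → ℝ) →ₗ[ℝ] (X → ℝ)}
    (h : IsTransposePair A B) (r : ℝ) : IsTransposePair (r • A) (r • B) := by
  intro u v
  simp only [LinearMap.smul_apply, Pi.smul_apply, smul_eq_mul]
  calc ∑ y, r * A u y * v y = r * ∑ y, A u y * v y := by rw [Finset.mul_sum]; exact Finset.sum_congr rfl fun y _ => by ring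
    _ = r * ∑ x, u x * B v x := by rw [h u v]
    _ = ∑ x, u x * (r * B v x) := by rw [Finset.mul_sum]; exact Finset.sum_congr rfl fun x _ => by ring

/-- ★★ **THE BLOCK-L² BOUND OF Δ′_π AT THE PINS — `StepL2.t`'s SHAPE — FROM THE THREE SUP SCHEMAS, (3.46)₄ AND THE PIN** (module docstring).  Inputs as in
`split_majorants_of_letter_schemas` (`q hq H 𝔬12`, numerics, `h31 h49 hBJ`), plus `h46` ((3.46)₄ at `DvcoKH ∘ GcoS(GpY) ∘ DvscoKH`, block-L²), the pin `hTpico12`, `B₄ δ₄`,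
`r ≤ δ₄`, and ONE displayed constant `t2L ≥ constL2 … (ℓ+1) · t_J`.  Output: `∃ ML`, and for every member with `ML ≤ M_x` in the regime, the block bound of `(𝔬12 x).Tpi U`
with kernel `t2L·(M_xα₀)·(Lʲη)⁻¹·(L^{j′}η)⁻¹·e^{−δ_T d}`. [cite: Balaban1985BackgroundPropagators, (3.130)–(3.131) pp.421–422, (3.120) p.419, Thm 3.1 (3.42) p.397 + (3.46) p.398, (3.49) p.399, (3.117) p.419, p.391; Balaban1984PropagatorsII, (2.54), (2.60)–(2.61) pp.233–234] -/
theorem blockBd_tpi_of_letter_schemasR_parG_J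
    (parT : ∀ i : B6KLevelCensusIndexV1.KIdx d ℓ hd hL b₀ b₁, Node00.SiteParY (Matrix (Fin N) (Fin N) ℂ) i) (q : PinPrims) (hq : q.OK) (H : MemberY d ℓ hd hL b₀ b₁ Mstar → Prop) {J : Type} (f : J → MemberY d ℓ hd hL b₀ b₁ Mstar)
    (R₁ R₂ : RegFamY d ℓ hd hL b₀ b₁ Mstar (Matrix (Fin N) (Fin N) ℂ)) (hG : MemOfFam (specialUnitaryUnits (Fin N)) R₁)
    (c : ℝ)
    (𝔬12 : ∀ x : MemberY d ℓ hd hL b₀ b₁ Mstar, B9Thm312Whole.Ops (geo9Y x) (bg9Y (Matrix (Fin N) (Fin N) ℂ) (specialUnitaryUnits (Fin N)) x)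
      (XBK (TrIdx N) x.toKIdx) (XBK (TrIdx N) x.toKIdx) (XHK (TrIdx N) x.toKIdx) (XSK (TrIdx N) x.toKIdx))
    (B₀ δ₀ CP δP tJ δB B₄ δ₄ r δT σS t2L M a : ℝ) (hB₀ : 0 ≤ B₀) (hCP : 0 ≤ CP) (htJ : 0 ≤ tJ) (hB₄ : 0 ≤ B₄) (hσS : 0 < σS) (hM : 0 < M)
    -- [CASCADE-K «K3-D», ed. G] the transporter-symmetry LAWS GUARDED by the regime (node00-def-Y ruling (α), I.19747): at the knit transporter they hold on the member class only
    (hsymT : ∀ x : MemberY d ℓ hd hL b₀ b₁ Mstar, M ≤ (geo9Y x).M → ∀ α₀ : ℝ, 0 < α₀ → (geo9Y x).M * α₀ ≤ a → ∀ U : (bg9YR (Matrix (Fin N) (Fin N) ℂ) (specialUnitaryUnits (Fin N)) R₁ R₂ x).Cfg, (bg9YR (Matrix (Fin N) (Fin N) ℂ) (specialUnitaryUnits (Fin N)) R₁ R₂ x).Reg335 c α₀ U →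
      B9Thm311ReadingCoords.IsSymmTr (fun _ => (1 : ℝ)) (Node00.GpY x.toKIdx (parT x.toKIdx) U))
    (hsymRT : ∀ x : MemberY d ℓ hd hL b₀ b₁ Mstar, M ≤ (geo9Y x).M → ∀ α₀ : ℝ, 0 < α₀ → (geo9Y x).M * α₀ ≤ a → ∀ U : (bg9YR (Matrix (Fin N) (Fin N) ℂ) (specialUnitaryUnits (Fin N)) R₁ R₂ x).Cfg, (bg9YR (Matrix (Fin N) (Fin N) ℂ) (specialUnitaryUnits (Fin N)) R₁ R₂ x).Reg335 c α₀ U →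
      B9Thm311ReadingCoords.IsSymmTr (fun _ => (1 : ℝ)) (Node00.RY x.toKIdx (parT x.toKIdx) (Node00.GpY x.toKIdx (parT x.toKIdx)) U))
    (hr₀ : r ≤ δ₀) (hrP : r ≤ δP) (hrB : r ≤ δB) (hr₄ : r ≤ δ₄) (hδT : 0 ≤ δT) (hδTr : δT + 2 * σS + 3 * (q.αF * ((1 - 2 * q.α) * q.δ₀)) ≤ r)
    (ht2L : constL2 (cR39 (trBasis N))⁻¹ B₀ CP B₄
      (rowConst261 (geo9Y (d := d) (ℓ := ℓ) (hd := hd) (hL := hL) (b₀ := b₀) (b₁ := b₁) (Mstar := Mstar)) σS) ((ℓ + 1 : ℕ) : ℝ) * tJ ≤ t2L)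
    (hTpico12 : ∀ (x : MemberY d ℓ hd hL b₀ b₁ Mstar) (U : (bg9Y (Matrix (Fin N) (Fin N) ℂ) (specialUnitaryUnits (Fin N)) x).Cfg), (𝔬12 x).Tpi U =
      TpicoK x.toKIdx (trBasis N) (bg9Y (Matrix (Fin N) (Fin N) ℂ) (specialUnitaryUnits (Fin N)) x) (fun U => U) (parT x.toKIdx)
        (GpPhysY x.toKIdx (parT x.toKIdx)) U)
    (h31 : ∀ x : MemberY d ℓ hd hL b₀ b₁ Mstar, M ≤ (geo9Y x).M → ∀ α₀ : ℝ, 0 < α₀ → (geo9Y x).M * α₀ ≤ a →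
      ∀ U : (bg9Y (Matrix (Fin N) (Fin N) ℂ) (specialUnitaryUnits (Fin N)) x).Cfg,
        (bg9YR (Matrix (Fin N) (Fin N) ℂ) (specialUnitaryUnits (Fin N)) R₁ R₂ x).Reg335 c α₀ U →
        (bg9YR (Matrix (Fin N) (Fin N) ℂ) (specialUnitaryUnits (Fin N)) R₁ R₂ x).Reg336 c α₀ U →
          Thm31GpMaj (𝔬12 x).blkW (𝔬12 x).blk
            (GcoS x.toKIdx (trBasis N) (bg9Y (Matrix (Fin N) (Fin N) ℂ) (specialUnitaryUnits (Fin N)) x) (fun U => U) (GpY x.toKIdx (parT x.toKIdx)) U)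
            (DvcoKH x.toKIdx (trBasis N) (bg9Y (Matrix (Fin N) (Fin N) ℂ) (specialUnitaryUnits (Fin N)) x) (fun U => U) U)
            (DvscoKH x.toKIdx (trBasis N) (bg9Y (Matrix (Fin N) (Fin N) ℂ) (specialUnitaryUnits (Fin N)) x) (fun U => U) U) 1 (H x) B₀ δ₀)
    (h46 : ∀ x : MemberY d ℓ hd hL b₀ b₁ Mstar, M ≤ (geo9Y x).M → ∀ α₀ : ℝ, 0 < α₀ → (geo9Y x).M * α₀ ≤ a →
      ∀ U : (bg9Y (Matrix (Fin N) (Fin N) ℂ) (specialUnitaryUnits (Fin N)) x).Cfg,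
        (bg9YR (Matrix (Fin N) (Fin N) ℂ) (specialUnitaryUnits (Fin N)) R₁ R₂ x).Reg335 c α₀ U →
        (bg9YR (Matrix (Fin N) (Fin N) ℂ) (specialUnitaryUnits (Fin N)) R₁ R₂ x).Reg336 c α₀ U →
          BlockBd (g := toB6 (geo9Y x) 1 (H x)) (𝔬12 x).blk (𝔬12 x).blk
            (DvcoKH x.toKIdx (trBasis N) (bg9Y (Matrix (Fin N) (Fin N) ℂ) (specialUnitaryUnits (Fin N)) x) (fun U => U) U ∘ₗ
              GcoS x.toKIdx (trBasis N) (bg9Y (Matrix (Fin N) (Fin N) ℂ) (specialUnitaryUnits (Fin N)) x) (fun U => U) (GpY x.toKIdx (parT x.toKIdx)) U ∘ₗ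
              DvscoKH x.toKIdx (trBasis N) (bg9Y (Matrix (Fin N) (Fin N) ℂ) (specialUnitaryUnits (Fin N)) x) (fun U => U) U)
            (fun (y y' : (geo9Y x).Site) => B₄ * Real.exp (-(δ₄ * (geo9Y x).dist y y'))))
    (h49 : ∀ j : J, M ≤ (geo9Y (f j)).M → ∀ α₀ : ℝ, 0 < α₀ → (geo9Y (f j)).M * α₀ ≤ a →
      ∀ U : (bg9Y (Matrix (Fin N) (Fin N) ℂ) (specialUnitaryUnits (Fin N)) (f j)).Cfg,
        (bg9YR (Matrix (Fin N) (Fin N) ℂ) (specialUnitaryUnits (Fin N)) R₁ R₂ (f j)).Reg335 c α₀ U →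
        (bg9YR (Matrix (Fin N) (Fin N) ℂ) (specialUnitaryUnits (Fin N)) R₁ R₂ (f j)).Reg336 c α₀ U →
          Proj349Maj (𝔬12 (f j)).blkW (𝔬12 (f j)).blk
            (PcoK (f j).toKIdx (trBasis N) (bg9Y (Matrix (Fin N) (Fin N) ℂ) (specialUnitaryUnits (Fin N)) (f j)) (fun U => U) (parT (f j).toKIdx)
              (GpY (f j).toKIdx (parT (f j).toKIdx)) U)
            (DvcoKH (f j).toKIdx (trBasis N) (bg9Y (Matrix (Fin N) (Fin N) ℂ) (specialUnitaryUnits (Fin N)) (f j)) (fun U => U) U)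
            (DvscoKH (f j).toKIdx (trBasis N) (bg9Y (Matrix (Fin N) (Fin N) ℂ) (specialUnitaryUnits (Fin N)) (f j)) (fun U => U) U) 1 (H (f j)) CP δP)
    (hBJ : ∀ x : MemberY d ℓ hd hL b₀ b₁ Mstar, M ≤ (geo9Y x).M → ∀ α₀ : ℝ, 0 < α₀ → (geo9Y x).M * α₀ ≤ a →
      ∀ U : (bg9Y (Matrix (Fin N) (Fin N) ℂ) (specialUnitaryUnits (Fin N)) x).Cfg,
        (bg9YR (Matrix (Fin N) (Fin N) ℂ) (specialUnitaryUnits (Fin N)) R₁ R₂ x).Reg335 c α₀ U →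
        (bg9YR (Matrix (Fin N) (Fin N) ℂ) (specialUnitaryUnits (Fin N)) R₁ R₂ x).Reg336 c α₀ U →
          CurrentMaj (𝔬12 x).blkW (𝔬12 x).blk
            (BcoKH x.toKIdx (trBasis N) (bg9Y (Matrix (Fin N) (Fin N) ℂ) (specialUnitaryUnits (Fin N)) x) (fun U => U) U)
            (BdcoKH x.toKIdx (trBasis N) (bg9Y (Matrix (Fin N) (Fin N) ℂ) (specialUnitaryUnits (Fin N)) x) (fun U => U) U) 1 (H x)
            (tJ * ((geo9Y x).M * α₀)) δB) :
    ∃ ML : ℝ, ∀ j : J, ML ≤ (geo9Y (f j)).M → M ≤ (geo9Y (f j)).M → ∀ α₀ : ℝ, 0 < α₀ → (geo9Y (f j)).M * α₀ ≤ a →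
      ∀ U : (bg9Y (Matrix (Fin N) (Fin N) ℂ) (specialUnitaryUnits (Fin N)) (f j)).Cfg,
        (bg9YR (Matrix (Fin N) (Fin N) ℂ) (specialUnitaryUnits (Fin N)) R₁ R₂ (f j)).Reg335 c α₀ U →
        (bg9YR (Matrix (Fin N) (Fin N) ℂ) (specialUnitaryUnits (Fin N)) R₁ R₂ (f j)).Reg336 c α₀ U →
          BlockBd (g := toB6 (geo9Y (f j)) 1 (H (f j))) (𝔬12 (f j)).blk (𝔬12 (f j)).blk ((𝔬12 (f j)).Tpi U)
            (fun (y y' : (geo9Y (f j)).Site) => t2L * ((geo9Y (f j)).M * α₀) * ((geo9Y (f j)).len y)⁻¹ * ((geo9Y (f j)).len y')⁻¹ *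
              Real.exp (-(δT * (geo9Y (f j)).dist y y'))) := by
  -- member facts at ((1 − 2α)δ₀, α_F) (n06-k) and [4] (2.61) at the rate σ_S with n06-i's DEFINITE constant, above ONE threshold each
  obtain ⟨ML, -, hfacts, -⟩ :=
    lemma21Pack_geo9Y (d := d) (ℓ := ℓ) (hd := hd) (hL := hL) (b₀ := b₀) (b₁ := b₁) (Mstar := Mstar) H hq.α_pos hq.α_lt
      hq.δ₀_pos hq.αF_pos (by linarith only [hq.αF_lt])
  obtain ⟨MLσ, hrowc⟩ := rowConst261_spec_of_rowSum261
    (rowSum261_geo9Y (d := d) (ℓ := ℓ) (hd := hd) (hL := hL) (b₀ := b₀) (b₁ := b₁) (Mstar := Mstar)) hσS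
  have hN : 0 < N := Nat.pos_of_ne_zero (NeZero.ne N)
  have hc0 : 0 < cR39 (trBasis N) := cR39_trBasis_pos hN
  have hcσ : 0 ≤ rowConst261 (geo9Y (d := d) (ℓ := ℓ) (hd := hd) (hL := hL) (b₀ := b₀) (b₁ := b₁) (Mstar := Mstar)) σS :=
    rowConst261_nonneg _ _
  have hτ : 0 ≤ q.αF * ((1 - 2 * q.α) * q.δ₀) :=
    mul_nonneg hq.αF_pos.le (mul_nonneg (by linarith only [hq.α_lt]) hq.δ₀_pos.le)
  refine ⟨max ML MLσ, fun j hMx hMM α₀ hα ha U hU hU' => ?_⟩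
  have hgeo : GeoOK (geo9Y (f j)) := ⟨geo9Y_dist_triangle (f j), geo9Y_dist_comm (f j), geo9K_dist_nonneg (f j).toKIdx, geo9Y_len_pos (f j)⟩
  have hF := hfacts (f j) ((le_max_left _ _).trans hMx)
  have hrow : RowSum (toB6 (geo9Y (f j)) 1 (H (f j))) σS
      (rowConst261 (geo9Y (d := d) (ℓ := ℓ) (hd := hd) (hL := hL) (b₀ := b₀) (b₁ := b₁) (Mstar := Mstar)) σS) :=
    fun y => hrowc (f j) ((le_max_right _ _).trans hMx) y
  have hθ : 0 ≤ (geo9Y (f j)).M * α₀ := mul_nonneg (hM.le.trans hMM) hα.le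
  -- the transpose facts at the trace basis (tree theorems; `U` is special-unitary by (3.35))
  have hUu : ∀ μ z, ((U μ z : (Matrix (Fin N) (Fin N) ℂ)ˣ) : Matrix (Fin N) (Fin N) ℂ) ∈ unitary (Matrix (Fin N) (Fin N) ℂ) :=
    fun μ z => specialUnitaryUnits_le_unitaryUnits (hG (f j) c α₀ U hU μ z)
  have hGsym := isTransposePair_GcoS_trBasis (f j).toKIdx (bg9Y (Matrix (Fin N) (Fin N) ℂ) (specialUnitaryUnits (Fin N)) (f j)) (fun U => U)
    (GpY (f j).toKIdx (parT (f j).toKIdx)) U (hsymT (f j) hMM α₀ hα ha U hU)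
  have hDv := isTransposePair_DvcoKH_DvscoKH (f j).toKIdx (bg9Y (Matrix (Fin N) (Fin N) ℂ) (specialUnitaryUnits (Fin N)) (f j)) (fun U => U) U hUu
  have hDG := hGsym.comp hDv
  have hRsym : IsTransposePair (RcoK (f j).toKIdx (trBasis N) (bg9Y (Matrix (Fin N) (Fin N) ℂ) (specialUnitaryUnits (Fin N)) (f j)) (fun U => U) (parT (f j).toKIdx) (GpY (f j).toKIdx (parT (f j).toKIdx)) U)
      (RcoK (f j).toKIdx (trBasis N) (bg9Y (Matrix (Fin N) (Fin N) ℂ) (specialUnitaryUnits (Fin N)) (f j)) (fun U => U) (parT (f j).toKIdx) (GpY (f j).toKIdx (parT (f j).toKIdx)) U) :=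
    isTransposePair_smul_smul (B9CoReadingCoordsTranspose.isTransposePair_coordOpK_of_isSymmTr (trBasis N) (B9CoReadingCoordsTranspose.trBasis_repr_eq_trace N) _ (hsymRT (f j) hMM α₀ hα ha U hU)) _
  have hPeq : PcoK (f j).toKIdx (trBasis N) (bg9Y (Matrix (Fin N) (Fin N) ℂ) (specialUnitaryUnits (Fin N)) (f j)) (fun U => U) (parT (f j).toKIdx)
      (GpY (f j).toKIdx (parT (f j).toKIdx)) U = 1 - (cR39 (trBasis N)) •
        RcoK (f j).toKIdx (trBasis N) (bg9Y (Matrix (Fin N) (Fin N) ℂ) (specialUnitaryUnits (Fin N)) (f j)) (fun U => U) (parT (f j).toKIdx) (GpY (f j).toKIdx (parT (f j).toKIdx)) U := by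
    rw [rcoK_eq, smul_smul, mul_inv_cancel₀ hc0.ne', one_smul, Module.End.one_eq_id, sub_sub_cancel]
  have hPsym : IsTransposePair
      (PcoK (f j).toKIdx (trBasis N) (bg9Y (Matrix (Fin N) (Fin N) ℂ) (specialUnitaryUnits (Fin N)) (f j)) (fun U => U) (parT (f j).toKIdx) (GpY (f j).toKIdx (parT (f j).toKIdx)) U)
      (PcoK (f j).toKIdx (trBasis N) (bg9Y (Matrix (Fin N) (Fin N) ℂ) (specialUnitaryUnits (Fin N)) (f j)) (fun U => U) (parT (f j).toKIdx) (GpY (f j).toKIdx (parT (f j).toKIdx)) U) := by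
    rw [hPeq]; exact isTransposePair_one.sub (isTransposePair_smul_smul hRsym _)
  have hDP := hPsym.comp hDv
  have hBB := isTransposePair_BcoKH_BdcoKH (f j).toKIdx (bg9Y (Matrix (Fin N) (Fin N) ℂ) (specialUnitaryUnits (Fin N)) (f j)) (fun U => U) U hUu
  -- the split and the two factorizations at the repaired pin
  have hsplit := (hTpico12 (f j) U).trans (tpicoK_eq_splitL (f j).toKIdx (trBasis N) (bg9Y (Matrix (Fin N) (Fin N) ℂ) (specialUnitaryUnits (Fin N)) (f j)) (fun U => U)
    (parT (f j).toKIdx) (GpPhysY (f j).toKIdx (parT (f j).toKIdx)) U)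
  have hmain := blockBd_tpi_of_split hgeo hF hrow (h31 (f j) hMM α₀ hα ha U hU hU') ⟨h46 (f j) hMM α₀ hα ha U hU hU'⟩ (h49 j hMM α₀ hα ha U hU hU')
    (hBJ (f j) hMM α₀ hα ha U hU hU') hGsym hDG hDP hBB
    (rcoK_eq (f j).toKIdx (trBasis N) (bg9Y (Matrix (Fin N) (Fin N) ℂ) (specialUnitaryUnits (Fin N)) (f j)) (fun U => U) (parT (f j).toKIdx) (GpY (f j).toKIdx (parT (f j).toKIdx)) U)
    hsplit (taLcoK_phys_eq_comp (f j).toKIdx (trBasis N) (bg9Y (Matrix (Fin N) (Fin N) ℂ) (specialUnitaryUnits (Fin N)) (f j)) (fun U => U) (parT (f j).toKIdx) hc0.ne' U)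
    (tbLcoKH_phys_eq_comp (f j).toKIdx (trBasis N) (bg9Y (Matrix (Fin N) (Fin N) ℂ) (specialUnitaryUnits (Fin N)) (f j)) (fun U => U) (parT (f j).toKIdx) hc0.ne' U)
    (inv_nonneg.mpr hc0.le) hB₀ hCP hB₄ (mul_nonneg htJ hθ) hcσ hσS.le hτ hr₀ hrP hrB hr₄ hδT hδTr
  refine hmain.mono fun y y' => ?_
  exact kernel_dom ht2L hθ (inv_nonneg.mpr (geo9Y_len_pos (f j) y).le) (inv_nonneg.mpr (geo9Y_len_pos (f j) y').le) (Real.exp_nonneg _)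

/-- ★★ **v1.1 — THE DISPLAYED BINDER `hstepL2` WITH THE Δ⁽²⁾_π LETTER PUSHED DOWN TO THE RAW RESIDUAL** (module docstring, v1.1): the inputs of
`blockBd_tpi_of_letter_schemas` plus the certificate's pin `hT2co12` of `(𝔬12 x).T2` at a residual family `Δ2`, ONE displayed line `hD2L2` — the block-L² bound
`θ₂·(M_xα₀)·(Lʲη)⁻¹(L^{j′}η)⁻¹e^{−δ₂d}` of `D2coK … (Δ2 x) U` ((3.137) in L² for the FREE residual Δ⁽²⁾ itself) —, `r ≤ δ₂`, the budget `δ_T + 3σ_S + 3·α_F·((1−2α)δ₀) ≤ r`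
and a displayed constant `t2P ≥ θ₂·constL2Pi (cR39 (trBasis N))⁻¹ B₀ C_P B₄ (rowConst261 geo9Y σ_S) (ℓ+1)` give, above ONE threshold, `StepL2 (𝔬12 x) 1 (H x) ((t2L + t2P)·(M_xα₀)) δ_T U`.
[cite: Balaban1985BackgroundPropagators, (3.130)–(3.131) pp.421–422, (3.135) p.422, (3.137)–(3.138) p.423, (3.46) p.398, Thm 3.1 (3.42) p.397, (3.49) p.399, (3.117) p.419; Balaban1984PropagatorsII, (2.54), (2.60)–(2.61) pp.233–234] -/
theorem stepL2_of_letter_schemas_residualR_parG_J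
    (parT : ∀ i : B6KLevelCensusIndexV1.KIdx d ℓ hd hL b₀ b₁, Node00.SiteParY (Matrix (Fin N) (Fin N) ℂ) i) (q : PinPrims) (hq : q.OK) (H : MemberY d ℓ hd hL b₀ b₁ Mstar → Prop) {J : Type} (f : J → MemberY d ℓ hd hL b₀ b₁ Mstar)
    (R₁ R₂ : RegFamY d ℓ hd hL b₀ b₁ Mstar (Matrix (Fin N) (Fin N) ℂ)) (hG : MemOfFam (specialUnitaryUnits (Fin N)) R₁)
    (c : ℝ)
    (𝔬12 : ∀ x : MemberY d ℓ hd hL b₀ b₁ Mstar, B9Thm312Whole.Ops (geo9Y x) (bg9Y (Matrix (Fin N) (Fin N) ℂ) (specialUnitaryUnits (Fin N)) x)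
      (XBK (TrIdx N) x.toKIdx) (XBK (TrIdx N) x.toKIdx) (XHK (TrIdx N) x.toKIdx) (XSK (TrIdx N) x.toKIdx))
    (Δ2 : ∀ x : MemberY d ℓ hd hL b₀ b₁ Mstar, Node00.BondOpY (Matrix (Fin N) (Fin N) ℂ) x.toKIdx)
    (B₀ δ₀ CP δP tJ δB B₄ δ₄ r δT σS t2L θ₂ δ₂ t2P M a : ℝ) (hB₀ : 0 ≤ B₀) (hCP : 0 ≤ CP) (htJ : 0 ≤ tJ) (hB₄ : 0 ≤ B₄) (hθ₂ : 0 ≤ θ₂)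
    (hσS : 0 < σS) (hM : 0 < M)
    -- [CASCADE-K «K3-D», ed. G] the transporter-symmetry LAWS GUARDED by the regime (node00-def-Y ruling (α), I.19747): at the knit transporter they hold on the member class only
    (hsymT : ∀ x : MemberY d ℓ hd hL b₀ b₁ Mstar, M ≤ (geo9Y x).M → ∀ α₀ : ℝ, 0 < α₀ → (geo9Y x).M * α₀ ≤ a → ∀ U : (bg9YR (Matrix (Fin N) (Fin N) ℂ) (specialUnitaryUnits (Fin N)) R₁ R₂ x).Cfg, (bg9YR (Matrix (Fin N) (Fin N) ℂ) (specialUnitaryUnits (Fin N)) R₁ R₂ x).Reg335 c α₀ U →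
      B9Thm311ReadingCoords.IsSymmTr (fun _ => (1 : ℝ)) (Node00.GpY x.toKIdx (parT x.toKIdx) U))
    (hsymRT : ∀ x : MemberY d ℓ hd hL b₀ b₁ Mstar, M ≤ (geo9Y x).M → ∀ α₀ : ℝ, 0 < α₀ → (geo9Y x).M * α₀ ≤ a → ∀ U : (bg9YR (Matrix (Fin N) (Fin N) ℂ) (specialUnitaryUnits (Fin N)) R₁ R₂ x).Cfg, (bg9YR (Matrix (Fin N) (Fin N) ℂ) (specialUnitaryUnits (Fin N)) R₁ R₂ x).Reg335 c α₀ U →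
      B9Thm311ReadingCoords.IsSymmTr (fun _ => (1 : ℝ)) (Node00.RY x.toKIdx (parT x.toKIdx) (Node00.GpY x.toKIdx (parT x.toKIdx)) U)) (hr₀ : r ≤ δ₀) (hrP : r ≤ δP) (hrB : r ≤ δB) (hr₄ : r ≤ δ₄) (hr₂ : r ≤ δ₂) (hδT : 0 ≤ δT)
    (hδTr : δT + 3 * σS + 3 * (q.αF * ((1 - 2 * q.α) * q.δ₀)) ≤ r)
    (ht2L : constL2 (cR39 (trBasis N))⁻¹ B₀ CP B₄
      (rowConst261 (geo9Y (d := d) (ℓ := ℓ) (hd := hd) (hL := hL) (b₀ := b₀) (b₁ := b₁) (Mstar := Mstar)) σS) ((ℓ + 1 : ℕ) : ℝ) * tJ ≤ t2L)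
    (ht2P : θ₂ * constL2Pi (cR39 (trBasis N))⁻¹ B₀ CP B₄
      (rowConst261 (geo9Y (d := d) (ℓ := ℓ) (hd := hd) (hL := hL) (b₀ := b₀) (b₁ := b₁) (Mstar := Mstar)) σS) ((ℓ + 1 : ℕ) : ℝ) ≤ t2P)
    (hTpico12 : ∀ (x : MemberY d ℓ hd hL b₀ b₁ Mstar) (U : (bg9Y (Matrix (Fin N) (Fin N) ℂ) (specialUnitaryUnits (Fin N)) x).Cfg), (𝔬12 x).Tpi U =
      TpicoK x.toKIdx (trBasis N) (bg9Y (Matrix (Fin N) (Fin N) ℂ) (specialUnitaryUnits (Fin N)) x) (fun U => U) (parT x.toKIdx)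
        (GpPhysY x.toKIdx (parT x.toKIdx)) U)
    (hT2co12 : ∀ (x : MemberY d ℓ hd hL b₀ b₁ Mstar) (U : (bg9Y (Matrix (Fin N) (Fin N) ℂ) (specialUnitaryUnits (Fin N)) x).Cfg), (𝔬12 x).T2 U =
      T2coK x.toKIdx (trBasis N) (bg9Y (Matrix (Fin N) (Fin N) ℂ) (specialUnitaryUnits (Fin N)) x) (fun U => U) (parT x.toKIdx)
        (GpPhysY x.toKIdx (parT x.toKIdx)) (Δ2 x) U)
    (h31 : ∀ x : MemberY d ℓ hd hL b₀ b₁ Mstar, M ≤ (geo9Y x).M → ∀ α₀ : ℝ, 0 < α₀ → (geo9Y x).M * α₀ ≤ a →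
      ∀ U : (bg9Y (Matrix (Fin N) (Fin N) ℂ) (specialUnitaryUnits (Fin N)) x).Cfg, (bg9YR (Matrix (Fin N) (Fin N) ℂ) (specialUnitaryUnits (Fin N)) R₁ R₂ x).Reg335 c α₀ U →
        (bg9YR (Matrix (Fin N) (Fin N) ℂ) (specialUnitaryUnits (Fin N)) R₁ R₂ x).Reg336 c α₀ U →
          Thm31GpMaj (𝔬12 x).blkW (𝔬12 x).blk
            (GcoS x.toKIdx (trBasis N) (bg9Y (Matrix (Fin N) (Fin N) ℂ) (specialUnitaryUnits (Fin N)) x) (fun U => U) (GpY x.toKIdx (parT x.toKIdx)) U)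
            (DvcoKH x.toKIdx (trBasis N) (bg9Y (Matrix (Fin N) (Fin N) ℂ) (specialUnitaryUnits (Fin N)) x) (fun U => U) U)
            (DvscoKH x.toKIdx (trBasis N) (bg9Y (Matrix (Fin N) (Fin N) ℂ) (specialUnitaryUnits (Fin N)) x) (fun U => U) U) 1 (H x) B₀ δ₀)
    (h46 : ∀ x : MemberY d ℓ hd hL b₀ b₁ Mstar, M ≤ (geo9Y x).M → ∀ α₀ : ℝ, 0 < α₀ → (geo9Y x).M * α₀ ≤ a →
      ∀ U : (bg9Y (Matrix (Fin N) (Fin N) ℂ) (specialUnitaryUnits (Fin N)) x).Cfg, (bg9YR (Matrix (Fin N) (Fin N) ℂ) (specialUnitaryUnits (Fin N)) R₁ R₂ x).Reg335 c α₀ U →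
        (bg9YR (Matrix (Fin N) (Fin N) ℂ) (specialUnitaryUnits (Fin N)) R₁ R₂ x).Reg336 c α₀ U →
          BlockBd (g := toB6 (geo9Y x) 1 (H x)) (𝔬12 x).blk (𝔬12 x).blk
            (DvcoKH x.toKIdx (trBasis N) (bg9Y (Matrix (Fin N) (Fin N) ℂ) (specialUnitaryUnits (Fin N)) x) (fun U => U) U ∘ₗ
              GcoS x.toKIdx (trBasis N) (bg9Y (Matrix (Fin N) (Fin N) ℂ) (specialUnitaryUnits (Fin N)) x) (fun U => U) (GpY x.toKIdx (parT x.toKIdx)) U ∘ₗ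
              DvscoKH x.toKIdx (trBasis N) (bg9Y (Matrix (Fin N) (Fin N) ℂ) (specialUnitaryUnits (Fin N)) x) (fun U => U) U)
            (fun (y y' : (geo9Y x).Site) => B₄ * Real.exp (-(δ₄ * (geo9Y x).dist y y'))))
    (h49 : ∀ j : J, M ≤ (geo9Y (f j)).M → ∀ α₀ : ℝ, 0 < α₀ → (geo9Y (f j)).M * α₀ ≤ a →
      ∀ U : (bg9Y (Matrix (Fin N) (Fin N) ℂ) (specialUnitaryUnits (Fin N)) (f j)).Cfg, (bg9YR (Matrix (Fin N) (Fin N) ℂ) (specialUnitaryUnits (Fin N)) R₁ R₂ (f j)).Reg335 c α₀ U →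
        (bg9YR (Matrix (Fin N) (Fin N) ℂ) (specialUnitaryUnits (Fin N)) R₁ R₂ (f j)).Reg336 c α₀ U →
          Proj349Maj (𝔬12 (f j)).blkW (𝔬12 (f j)).blk
            (PcoK (f j).toKIdx (trBasis N) (bg9Y (Matrix (Fin N) (Fin N) ℂ) (specialUnitaryUnits (Fin N)) (f j)) (fun U => U) (parT (f j).toKIdx)
              (GpY (f j).toKIdx (parT (f j).toKIdx)) U)
            (DvcoKH (f j).toKIdx (trBasis N) (bg9Y (Matrix (Fin N) (Fin N) ℂ) (specialUnitaryUnits (Fin N)) (f j)) (fun U => U) U)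
            (DvscoKH (f j).toKIdx (trBasis N) (bg9Y (Matrix (Fin N) (Fin N) ℂ) (specialUnitaryUnits (Fin N)) (f j)) (fun U => U) U) 1 (H (f j)) CP δP)
    (hBJ : ∀ x : MemberY d ℓ hd hL b₀ b₁ Mstar, M ≤ (geo9Y x).M → ∀ α₀ : ℝ, 0 < α₀ → (geo9Y x).M * α₀ ≤ a →
      ∀ U : (bg9Y (Matrix (Fin N) (Fin N) ℂ) (specialUnitaryUnits (Fin N)) x).Cfg, (bg9YR (Matrix (Fin N) (Fin N) ℂ) (specialUnitaryUnits (Fin N)) R₁ R₂ x).Reg335 c α₀ U →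
        (bg9YR (Matrix (Fin N) (Fin N) ℂ) (specialUnitaryUnits (Fin N)) R₁ R₂ x).Reg336 c α₀ U →
          CurrentMaj (𝔬12 x).blkW (𝔬12 x).blk
            (BcoKH x.toKIdx (trBasis N) (bg9Y (Matrix (Fin N) (Fin N) ℂ) (specialUnitaryUnits (Fin N)) x) (fun U => U) U)
            (BdcoKH x.toKIdx (trBasis N) (bg9Y (Matrix (Fin N) (Fin N) ℂ) (specialUnitaryUnits (Fin N)) x) (fun U => U) U) 1 (H x)
            (tJ * ((geo9Y x).M * α₀)) δB)
    (hD2L2 : ∀ j : J, M ≤ (geo9Y (f j)).M → ∀ α₀ : ℝ, 0 < α₀ → (geo9Y (f j)).M * α₀ ≤ a →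
      ∀ U : (bg9Y (Matrix (Fin N) (Fin N) ℂ) (specialUnitaryUnits (Fin N)) (f j)).Cfg, (bg9YR (Matrix (Fin N) (Fin N) ℂ) (specialUnitaryUnits (Fin N)) R₁ R₂ (f j)).Reg335 c α₀ U →
        (bg9YR (Matrix (Fin N) (Fin N) ℂ) (specialUnitaryUnits (Fin N)) R₁ R₂ (f j)).Reg336 c α₀ U →
          BlockBd (g := toB6 (geo9Y (f j)) 1 (H (f j))) (𝔬12 (f j)).blk (𝔬12 (f j)).blk
            (D2coK (f j).toKIdx (trBasis N) (bg9Y (Matrix (Fin N) (Fin N) ℂ) (specialUnitaryUnits (Fin N)) (f j)) (fun U => U) (Δ2 (f j)) U)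
            (fun (y y' : (geo9Y (f j)).Site) => θ₂ * ((geo9Y (f j)).M * α₀) * ((geo9Y (f j)).len y)⁻¹ * ((geo9Y (f j)).len y')⁻¹ *
              Real.exp (-(δ₂ * (geo9Y (f j)).dist y y')))) :
    ∃ ML : ℝ, ∀ j : J, ML ≤ (geo9Y (f j)).M → M ≤ (geo9Y (f j)).M → ∀ α₀ : ℝ, 0 < α₀ → (geo9Y (f j)).M * α₀ ≤ a →
      ∀ U : (bg9Y (Matrix (Fin N) (Fin N) ℂ) (specialUnitaryUnits (Fin N)) (f j)).Cfg, (bg9YR (Matrix (Fin N) (Fin N) ℂ) (specialUnitaryUnits (Fin N)) R₁ R₂ (f j)).Reg335 c α₀ U →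
        (bg9YR (Matrix (Fin N) (Fin N) ℂ) (specialUnitaryUnits (Fin N)) R₁ R₂ (f j)).Reg336 c α₀ U →
          StepL2 (𝔬12 (f j)) 1 (H (f j)) ((t2L + t2P) * ((geo9Y (f j)).M * α₀)) δT U := by
  have hδTr2 : δT + 2 * σS + 3 * (q.αF * ((1 - 2 * q.α) * q.δ₀)) ≤ r := by linarith
  obtain ⟨ML1, hML1⟩ := blockBd_tpi_of_letter_schemasR_parG_J parT (hsymT := hsymT) (hsymRT := hsymRT) q hq H f R₁ R₂ hG c 𝔬12 B₀ δ₀ CP δP tJ δB B₄ δ₄ r δT σS t2L M a hB₀ hCP htJ hB₄ hσS hM hr₀ hrP hrB hr₄ hδT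
    hδTr2 ht2L hTpico12 h31 h46 h49 hBJ
  obtain ⟨ML2, -, hfacts, -⟩ :=
    lemma21Pack_geo9Y (d := d) (ℓ := ℓ) (hd := hd) (hL := hL) (b₀ := b₀) (b₁ := b₁) (Mstar := Mstar) H hq.α_pos hq.α_lt
      hq.δ₀_pos hq.αF_pos (by linarith only [hq.αF_lt])
  obtain ⟨MLσ, hrowc⟩ := rowConst261_spec_of_rowSum261
    (rowSum261_geo9Y (d := d) (ℓ := ℓ) (hd := hd) (hL := hL) (b₀ := b₀) (b₁ := b₁) (Mstar := Mstar)) hσS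
  have hc0 : 0 < cR39 (trBasis N) := cR39_trBasis_pos (Nat.pos_of_ne_zero (NeZero.ne N))
  have hcσ : 0 ≤ rowConst261 (geo9Y (d := d) (ℓ := ℓ) (hd := hd) (hL := hL) (b₀ := b₀) (b₁ := b₁) (Mstar := Mstar)) σS := rowConst261_nonneg _ _
  have hτ : 0 ≤ q.αF * ((1 - 2 * q.α) * q.δ₀) := mul_nonneg hq.αF_pos.le (mul_nonneg (by linarith only [hq.α_lt]) hq.δ₀_pos.le)
  refine ⟨max ML1 (max ML2 MLσ), fun j hMx hMM α₀ hα ha U hU hU' => ?_⟩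
  have hgeo : GeoOK (geo9Y (f j)) := ⟨geo9Y_dist_triangle (f j), geo9Y_dist_comm (f j), geo9K_dist_nonneg (f j).toKIdx, geo9Y_len_pos (f j)⟩
  have hF := hfacts (f j) ((le_max_left _ _).trans ((le_max_right _ _).trans hMx))
  have hrow : RowSum (toB6 (geo9Y (f j)) 1 (H (f j))) σS
      (rowConst261 (geo9Y (d := d) (ℓ := ℓ) (hd := hd) (hL := hL) (b₀ := b₀) (b₁ := b₁) (Mstar := Mstar)) σS) :=
    fun y => hrowc (f j) ((le_max_right _ _).trans ((le_max_right _ _).trans hMx)) y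
  have hθ : 0 ≤ (geo9Y (f j)).M * α₀ := mul_nonneg (hM.le.trans hMM) hα.le
  have hUu : ∀ μ z, ((U μ z : (Matrix (Fin N) (Fin N) ℂ)ˣ) : Matrix (Fin N) (Fin N) ℂ) ∈ unitary (Matrix (Fin N) (Fin N) ℂ) :=
    fun μ z => specialUnitaryUnits_le_unitaryUnits (hG (f j) c α₀ U hU μ z)
  have hGsym := isTransposePair_GcoS_trBasis (f j).toKIdx (bg9Y (Matrix (Fin N) (Fin N) ℂ) (specialUnitaryUnits (Fin N)) (f j)) (fun U => U)
    (GpY (f j).toKIdx (parT (f j).toKIdx)) U (hsymT (f j) hMM α₀ hα ha U hU)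
  have hDv := isTransposePair_DvcoKH_DvscoKH (f j).toKIdx (bg9Y (Matrix (Fin N) (Fin N) ℂ) (specialUnitaryUnits (Fin N)) (f j)) (fun U => U) U hUu
  have hRsym : IsTransposePair (RcoK (f j).toKIdx (trBasis N) (bg9Y (Matrix (Fin N) (Fin N) ℂ) (specialUnitaryUnits (Fin N)) (f j)) (fun U => U) (parT (f j).toKIdx) (GpY (f j).toKIdx (parT (f j).toKIdx)) U)
      (RcoK (f j).toKIdx (trBasis N) (bg9Y (Matrix (Fin N) (Fin N) ℂ) (specialUnitaryUnits (Fin N)) (f j)) (fun U => U) (parT (f j).toKIdx) (GpY (f j).toKIdx (parT (f j).toKIdx)) U) :=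
    isTransposePair_smul_smul (B9CoReadingCoordsTranspose.isTransposePair_coordOpK_of_isSymmTr (trBasis N) (B9CoReadingCoordsTranspose.trBasis_repr_eq_trace N) _ (hsymRT (f j) hMM α₀ hα ha U hU)) _
  have hPeq : PcoK (f j).toKIdx (trBasis N) (bg9Y (Matrix (Fin N) (Fin N) ℂ) (specialUnitaryUnits (Fin N)) (f j)) (fun U => U) (parT (f j).toKIdx)
      (GpY (f j).toKIdx (parT (f j).toKIdx)) U = 1 - (cR39 (trBasis N)) •
        RcoK (f j).toKIdx (trBasis N) (bg9Y (Matrix (Fin N) (Fin N) ℂ) (specialUnitaryUnits (Fin N)) (f j)) (fun U => U) (parT (f j).toKIdx) (GpY (f j).toKIdx (parT (f j).toKIdx)) U := by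
    rw [rcoK_eq, smul_smul, mul_inv_cancel₀ hc0.ne', one_smul, Module.End.one_eq_id, sub_sub_cancel]
  have hPsym : IsTransposePair
      (PcoK (f j).toKIdx (trBasis N) (bg9Y (Matrix (Fin N) (Fin N) ℂ) (specialUnitaryUnits (Fin N)) (f j)) (fun U => U) (parT (f j).toKIdx) (GpY (f j).toKIdx (parT (f j).toKIdx)) U)
      (PcoK (f j).toKIdx (trBasis N) (bg9Y (Matrix (Fin N) (Fin N) ℂ) (specialUnitaryUnits (Fin N)) (f j)) (fun U => U) (parT (f j).toKIdx) (GpY (f j).toKIdx (parT (f j).toKIdx)) U) := by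
    rw [hPeq]; exact isTransposePair_one.sub (isTransposePair_smul_smul hRsym _)
  have hT2 := (hT2co12 (f j) U).trans (t2coK_phys_eq_sandwich (f j).toKIdx (trBasis N) (bg9Y (Matrix (Fin N) (Fin N) ℂ) (specialUnitaryUnits (Fin N)) (f j)) (fun U => U)
    (parT (f j).toKIdx) (Δ2 (f j)) hc0.ne' U)
  have ht2 := blockBd_t2_of_residual hgeo hF hrow (h31 (f j) hMM α₀ hα ha U hU hU') ⟨h46 (f j) hMM α₀ hα ha U hU hU'⟩ (h49 j hMM α₀ hα ha U hU hU')
    (hGsym.comp hDv) (hPsym.comp hDv)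
    (rcoK_eq (f j).toKIdx (trBasis N) (bg9Y (Matrix (Fin N) (Fin N) ℂ) (specialUnitaryUnits (Fin N)) (f j)) (fun U => U) (parT (f j).toKIdx) (GpY (f j).toKIdx (parT (f j).toKIdx)) U)
    (hD2L2 j hMM α₀ hα ha U hU hU') hT2 (inv_nonneg.mpr hc0.le) hB₀ hCP hB₄ (mul_nonneg hθ₂ hθ) hcσ hσS.le hτ hr₀ hrP hr₄ hr₂ hδT hδTr
  have ht2' : BlockBd (g := toB6 (geo9Y (f j)) 1 (H (f j))) (𝔬12 (f j)).blk (𝔬12 (f j)).blk ((𝔬12 (f j)).T2 U)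
      (fun (y y' : (geo9Y (f j)).Site) => t2P * ((geo9Y (f j)).M * α₀) * ((geo9Y (f j)).len y)⁻¹ * ((geo9Y (f j)).len y')⁻¹ * Real.exp (-(δT * (geo9Y (f j)).dist y y'))) := by
    refine ht2.mono fun y y' => ?_
    have hK : θ₂ * ((geo9Y (f j)).M * α₀) * constL2Pi (cR39 (trBasis N))⁻¹ B₀ CP B₄
        (rowConst261 (geo9Y (d := d) (ℓ := ℓ) (hd := hd) (hL := hL) (b₀ := b₀) (b₁ := b₁) (Mstar := Mstar)) σS) (geo9Y (f j)).L ≤ t2P * ((geo9Y (f j)).M * α₀) := by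
      calc θ₂ * ((geo9Y (f j)).M * α₀) * constL2Pi (cR39 (trBasis N))⁻¹ B₀ CP B₄ (rowConst261 geo9Y σS) (geo9Y (f j)).L
          = θ₂ * constL2Pi (cR39 (trBasis N))⁻¹ B₀ CP B₄ (rowConst261 geo9Y σS) (geo9Y (f j)).L * ((geo9Y (f j)).M * α₀) := by ring
        _ ≤ t2P * ((geo9Y (f j)).M * α₀) := mul_le_mul_of_nonneg_right ht2P hθ
    exact mul_le_mul_of_nonneg_right (mul_le_mul_of_nonneg_right (mul_le_mul_of_nonneg_right hK (inv_nonneg.mpr (geo9Y_len_pos (f j) y).le))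
      (inv_nonneg.mpr (geo9Y_len_pos (f j) y').le)) (Real.exp_nonneg _)
  have h := stepL2_of_blockBd hgeo (mul_nonneg ((mul_nonneg hθ₂ (constL2Pi_nonneg _ _ _ _ _ _)).trans ht2P) hθ) (hML1 j ((le_max_left _ _).trans hMx) hMM α₀ hα ha U hU hU') ht2'
  rwa [← add_mul] at h

end Summit.QuantumFields.YangMills.BalabanUVNodes.N06StepL2AtPinsPhysRParGJ
end
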